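import Summits.QuantumFields.YangMills.Theorems.SoloBlindMeanPlaquette
import Literature.MathematicalPhysics.QuantumFieldTheory.LatticeGaugeStringTensionProofs
import HarnessLib

/-!
# The single-plaquette expectation at weak coupling (soloist rung D6′)

Solo seat `solo-QuantumFields-blind`, new mathematics for the conjunct `YangMills` of
`Summit.QuantumFields` (weak-coupling one-point function of the torus Wilson theory).

`SoloBlindMeanPlaquette` proves that `β ⟨S⟩_{Λ,β} / #plaquettes → N²/d` (large `β`, then large
tori) for every unitary model. Here the volume average is removed: by the **lattice symmetries of
the torus Wilson state** — translations (tree: `wilsonExpectation_comp_torusConfigShift`) and the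
exchange of any two coordinate axes (proved here for a general transposition `Equiv.swap a b`,
generalising the tree's `StringTension.wilsonExpectation_comp_swap` for `0 ↔ 1`) — every plaquette
of the torus has the same expected cost `⟨N - Re tr ρ(U_p)⟩_{Λ,β}`, in either orientation, so that

* `wilsonExpectation_wilsonAction_eq_card_mul` — `⟨S⟩_{Λ,β} = #plaquettes · ⟨N - Re tr ρ(U_{x,ij})⟩_{Λ,β}`
  for every site `x` and every pair of distinct directions `i ≠ j`;
* `weakCoupling_singlePlaquette` — for `d ≥ 2`, `N ≥ 1` and every unitary model (`G ≅ U(N)`):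
  `∀ ε > 0, ∀ᶠ β → ∞, ∀ᶠ L → ∞, ∀ x, ∀ i ≠ j, |β ⟨N - Re tr ρ(U_{x,ij})⟩_{Λ_{L+1},β} - N²/d| ≤ ε`.

The axis-exchange invariance of the torus Wilson measure (`wilsonExpectation_comp_swap`) is the
hypothesis (h1) that several Literature interfaces bundle (`permuteConfig`); for transpositions it
is proved here from `measurePreserving_arrowCongr'` and the invariance of the Wilson action
(a plaquette goes to a plaquette, possibly traversed backwards, and `Re tr ρ(g⁻¹) = Re tr ρ(g)`).

References: S. Chatterjee, *The leading term of the Yang–Mills free energy*, J. Funct. Anal. 271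
(2016) 2944–3005, arXiv:1602.01222, Thm. 2.1 (the free energy); E. Seiler, LNP 159 (1982), Ch. 2
(lattice symmetries of the Wilson state). [folklore]
-/

open MeasureTheory Filter Topology
open Literature.MathematicalPhysics.QuantumFieldTheory Literature.RepresentationTheory.CompactGroups

noncomputable section

namespace Summit.QuantumFields.YangMills.Theorems.SoloBlind

/-! ### Exchange of two coordinate axes (general transposition) -/

section Swap

variable {d L N : ℕ} {G : Type*} [Group G]

/-- Permuting coordinates commutes with displacements:
`(x + c eᵢ) ∘ σ = x ∘ σ + c e_{σ i}` for the transposition `σ = (a b)`. [folklore] -/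
theorem comp_swap_add_single (a b : Fin d) (x : Site d L) (i : Fin d) (c : ZMod L) :
    (fun k => (x + Pi.single i c : Site d L) (Equiv.swap a b k)) =
      (fun k => x (Equiv.swap a b k)) + Pi.single (Equiv.swap a b i) c := by
  funext k
  simp only [Pi.add_apply]
  congr 1
  by_cases hk : Equiv.swap a b k = i
  · have hk' : k = Equiv.swap a b i := by rw [← hk, Equiv.swap_apply_self]
    rw [hk, hk', Pi.single_eq_same, Pi.single_eq_same]
  · have hk' : k ≠ Equiv.swap a b i := fun h => hk (by rw [h, Equiv.swap_apply_self])
    rw [Pi.single_eq_of_ne hk, Pi.single_eq_of_ne hk']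

/-- Plaquette holonomies of the coordinate-exchanged configuration. [folklore] -/
theorem plaquetteHolonomy_swap (a b : Fin d) (U : GaugeConfig d L G) (x : Site d L) (i j : Fin d) :
    plaquetteHolonomy (fun e : Edge d L => U ((fun k' => e.1 (Equiv.swap a b k')),
        Equiv.swap a b e.2)) x i j =
      plaquetteHolonomy U (fun k' => x (Equiv.swap a b k')) (Equiv.swap a b i)
        (Equiv.swap a b j) := by
  simp only [plaquetteHolonomy, Site.shift, comp_swap_add_single]

/-- The exchange of the two directions of a plaquette index (`σ i`, `σ j` reordered). [folklore] -/
theorem swap_lt_or_lt (a b : Fin d) {i j : Fin d} (h : i < j) :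
    Equiv.swap a b i < Equiv.swap a b j ∨ Equiv.swap a b j < Equiv.swap a b i := by
  rcases lt_trichotomy (Equiv.swap a b i) (Equiv.swap a b j) with h' | h' | h'
  · exact Or.inl h'
  · exact absurd ((Equiv.swap a b).injective h') (ne_of_lt h)
  · exact Or.inr h'

/-- **The Wilson action is invariant under the exchange of two coordinate axes** (a plaquette goes
to a plaquette, possibly traversed backwards; `Re tr ρ(g⁻¹) = Re tr ρ(g)`). [folklore] -/
theorem wilsonAction_swap [NeZero L] [TopologicalSpace G] [IsTopologicalGroup G] [CompactSpace G]
    (ρ : G →* Matrix (Fin N) (Fin N) ℂ) (hρ : Continuous ρ) (a b : Fin d) (U : GaugeConfig d L G) :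
    wilsonAction ρ (fun e : Edge d L =>
        U ((fun k' => e.1 (Equiv.swap a b k')), Equiv.swap a b e.2)) =
      wilsonAction ρ U := by
  have hne : ∀ q : {p : Fin d × Fin d // p.1 < p.2},
      ¬ Equiv.swap a b q.1.1 < Equiv.swap a b q.1.2 → Equiv.swap a b q.1.2 < Equiv.swap a b q.1.1 :=
    fun q h => (swap_lt_or_lt a b q.2).resolve_left h
  set f : Plaquette d L → Plaquette d L := fun p =>
    ((fun k' => p.1 (Equiv.swap a b k')),
      if h : Equiv.swap a b p.2.1.1 < Equiv.swap a b p.2.1.2 then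
        ⟨(Equiv.swap a b p.2.1.1, Equiv.swap a b p.2.1.2), h⟩
      else ⟨(Equiv.swap a b p.2.1.2, Equiv.swap a b p.2.1.1), hne p.2 h⟩) with hf
  have hinv : Function.Involutive f := by
    intro p
    obtain ⟨x, ⟨⟨i, j⟩, hij⟩⟩ := p
    simp only [hf]
    refine Prod.ext ?_ ?_
    · funext k
      simp only [Equiv.swap_apply_self]
    · by_cases h : Equiv.swap a b i < Equiv.swap a b j
      · simp only [h, ↓reduceDIte, Equiv.swap_apply_self, hij]
      · simp only [h, ↓reduceDIte, Equiv.swap_apply_self, dif_neg (lt_asymm hij)]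
  unfold wilsonAction
  refine Finset.sum_equiv (Function.Involutive.toPerm f hinv) (fun p => by simp) fun p _ => ?_
  obtain ⟨x, ⟨⟨i, j⟩, hij⟩⟩ := p
  simp only [Function.Involutive.coe_toPerm, hf]
  rw [plaquetteHolonomy_swap]
  by_cases h : Equiv.swap a b i < Equiv.swap a b j
  · simp only [h, ↓reduceDIte]
  · simp only [h, ↓reduceDIte]
    rw [StringTension.plaquetteHolonomy_symm U _ (Equiv.swap a b j) (Equiv.swap a b i),
      CompactGroup.re_trace_map_inv ρ hρ]

variable [TopologicalSpace G] [IsTopologicalGroup G] [CompactSpace G] [MeasurableSpace G]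
  [BorelSpace G] (ρ : G →* Matrix (Fin N) (Fin N) ℂ)

/-- **The torus Wilson expectation is invariant under the exchange of two coordinate axes** (the
product Haar measure is invariant under the induced permutation of links, the Wilson action by
`wilsonAction_swap`). [folklore] -/
theorem wilsonExpectation_comp_swap [NeZero L] (hρ : Continuous ρ) (β : ℝ) (a b : Fin d)
    (F : GaugeConfig d L G → ℝ) :
    wilsonExpectation ρ β (fun U => F (fun e : Edge d L =>
        U ((fun k' => e.1 (Equiv.swap a b k')), Equiv.swap a b e.2))) =
      wilsonExpectation ρ β F := by
  set g : Edge d L → Edge d L := fun e =>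
    ((fun k' => e.1 (Equiv.swap a b k')), Equiv.swap a b e.2) with hg
  have hginv : Function.Involutive g := by
    intro e
    obtain ⟨x, i⟩ := e
    simp only [hg, Equiv.swap_apply_self]
  set eσ : GaugeConfig d L G ≃ᵐ GaugeConfig d L G :=
    MeasurableEquiv.arrowCongr' (Function.Involutive.toPerm g hginv) (MeasurableEquiv.refl G)
    with heσ
  have heσ_apply : ∀ U : GaugeConfig d L G, eσ U = fun e => U (g e) := by
    intro U
    funext e
    show U ((Function.Involutive.toPerm g hginv).symm e) = U (g e)
    rw [Function.Involutive.toPerm_symm, Function.Involutive.coe_toPerm]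
  have hπ : (Measure.pi fun _ : Edge d L => haarProbability G).map eσ =
      Measure.pi fun _ : Edge d L => haarProbability G :=
    (measurePreserving_arrowCongr' (fun _ : Edge d L => haarProbability G)
      (fun _ : Edge d L => haarProbability G) (Function.Involutive.toPerm g hginv)
      (MeasurableEquiv.refl G) fun _ => MeasurePreserving.id _).map_eq
  have hμ : (wilsonMeasure ρ β).map eσ = wilsonMeasure (d := d) (L := L) (G := G) ρ β := by
    simp only [wilsonMeasure, Measure.map_smul, wilsonWeight]
    rw [withDensity_map_of_measurableEquiv _ _ _ hπ]
    intro U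
    rw [heσ_apply, hg, wilsonAction_swap ρ hρ]
  have hcomp : (fun U => F (fun e : Edge d L =>
      U ((fun k' => e.1 (Equiv.swap a b k')), Equiv.swap a b e.2))) = F ∘ eσ := by
    funext U
    rw [Function.comp_apply, heσ_apply]
  rw [hcomp]
  simp only [wilsonExpectation, Function.comp_apply]
  rw [← integral_map_equiv, hμ]

end Swap

/-! ### The single-plaquette cost and its expectation -/

section Plaquette

variable {d L N : ℕ} {G : Type*} [Group G] [TopologicalSpace G] [IsTopologicalGroup G]
  [CompactSpace G] [MeasurableSpace G] [BorelSpace G] (ρ : G →* Matrix (Fin N) (Fin N) ℂ)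

/-- The cost `φ_{x,ij}(U) = N - Re tr ρ(U_{x,ij})` of the plaquette at `x` in the (ordered) pair
of directions `(i, j)`. [folklore] -/
def plaquetteCost (x : Site d L) (i j : Fin d) (U : GaugeConfig d L G) : ℝ :=
  (N : ℝ) - ((ρ (plaquetteHolonomy U x i j)).trace).re

omit [TopologicalSpace G] [IsTopologicalGroup G] [CompactSpace G] [MeasurableSpace G]
  [BorelSpace G] in
/-- The Wilson action is the sum of the plaquette costs. [folklore] -/
theorem wilsonAction_eq_sum_plaquetteCost [NeZero L] (U : GaugeConfig d L G) :
    wilsonAction ρ U = ∑ p : Plaquette d L, plaquetteCost ρ p.1 p.2.1.1 p.2.1.2 U := rfl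

omit [MeasurableSpace G] [BorelSpace G] in
/-- The cost does not depend on the orientation of the plaquette. [folklore] -/
theorem plaquetteCost_symm (hρ : Continuous ρ) (x : Site d L) (i j : Fin d) (U : GaugeConfig d L G) :
    plaquetteCost ρ x j i U = plaquetteCost ρ x i j U := by
  simp only [plaquetteCost, StringTension.plaquetteHolonomy_symm U x i j,
    CompactGroup.re_trace_map_inv ρ hρ]

omit [MeasurableSpace G] [BorelSpace G] in
/-- `|φ_{x,ij}| ≤ 2N`. [folklore] -/
theorem abs_plaquetteCost_le (hρ : Continuous ρ) (x : Site d L) (i j : Fin d)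
    (U : GaugeConfig d L G) : |plaquetteCost ρ x i j U| ≤ 2 * N := by
  have h := CompactGroup.abs_re_trace_le_card ρ hρ (plaquetteHolonomy U x i j)
  simp only [Fintype.card_fin] at h
  unfold plaquetteCost
  have := abs_le.1 h
  rw [abs_le]
  constructor <;> linarith [this.1, this.2]

omit [CompactSpace G] in
/-- The cost of a genuine plaquette (`i < j`) is measurable. [folklore] -/
theorem measurable_plaquetteCost (hρ : Continuous ρ) (p : Plaquette d L) :
    Measurable (plaquetteCost (G := G) ρ p.1 p.2.1.1 p.2.1.2) :=
  measurable_const.sub (WilsonRP.measurable_plaqRe ρ hρ p)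

/-- The cost of a genuine plaquette is integrable for the torus Wilson state. [folklore] -/
theorem integrable_plaquetteCost [NeZero L] (hρ : Continuous ρ) (β : ℝ) (p : Plaquette d L) :
    Integrable (plaquetteCost (G := G) ρ p.1 p.2.1.1 p.2.1.2) (wilsonMeasure ρ β) := by
  haveI := isProbabilityMeasure_wilsonMeasure (d := d) (L := L) ρ hρ β
  exact Integrable.of_bound (measurable_plaquetteCost ρ hρ p).aestronglyMeasurable (2 * N)
    (ae_of_all _ fun U => by rw [Real.norm_eq_abs]; exact abs_plaquetteCost_le ρ hρ _ _ _ U)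

/-- Translation invariance: the expected cost does not depend on the base point. [folklore] -/
theorem wilsonExpectation_plaquetteCost_translate [NeZero L] (β : ℝ) (x : Site d L) (i j : Fin d) :
    wilsonExpectation ρ β (plaquetteCost ρ x i j) =
      wilsonExpectation ρ β (plaquetteCost ρ (0 : Site d L) i j) := by
  rw [← wilsonExpectation_comp_torusConfigShift ρ β (-x) (plaquetteCost ρ (0 : Site d L) i j)]
  congr 1
  funext U
  simp only [Function.comp_apply, plaquetteCost, plaquetteHolonomy_torusConfigShift, zero_sub,
    neg_neg]

/-- Axis-exchange invariance of the expected cost at the origin. [folklore] -/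
theorem wilsonExpectation_plaquetteCost_swap [NeZero L] (hρ : Continuous ρ) (β : ℝ)
    (a b i j : Fin d) :
    wilsonExpectation ρ β (plaquetteCost ρ (0 : Site d L) (Equiv.swap a b i) (Equiv.swap a b j)) =
      wilsonExpectation ρ β (plaquetteCost ρ (0 : Site d L) i j) := by
  rw [← wilsonExpectation_comp_swap ρ hρ β a b (plaquetteCost ρ (0 : Site d L) i j)]
  congr 1
  funext U
  simp only [plaquetteCost, plaquetteHolonomy_swap]
  rfl

/-- **All plaquettes of the torus have the same expected cost** (any two ordered pairs of distinct
directions are related by two transpositions; orientation is immaterial). [folklore] -/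
theorem wilsonExpectation_plaquetteCost_eq [NeZero L] (hρ : Continuous ρ) (β : ℝ) (x : Site d L)
    {i j i' j' : Fin d} (hij : i ≠ j) (hij' : i' ≠ j') :
    wilsonExpectation ρ β (plaquetteCost ρ x i j) =
      wilsonExpectation ρ β (plaquetteCost ρ (0 : Site d L) i' j') := by
  rw [wilsonExpectation_plaquetteCost_translate]
  -- first transposition: `i ↦ i'`
  have h1 := wilsonExpectation_plaquetteCost_swap (L := L) ρ hρ β i i' i j
  rw [Equiv.swap_apply_left] at h1
  set j₁ : Fin d := Equiv.swap i i' j with hj₁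
  have hj₁i' : j₁ ≠ i' := by
    intro h
    apply hij
    have : Equiv.swap i i' j = Equiv.swap i i' i := by rw [Equiv.swap_apply_left]; exact h
    exact ((Equiv.swap i i').injective this).symm
  -- second transposition: `j₁ ↦ j'`, fixing `i'`
  have h2 := wilsonExpectation_plaquetteCost_swap (L := L) ρ hρ β j₁ j' i' j₁
  rw [Equiv.swap_apply_of_ne_of_ne hj₁i'.symm hij', Equiv.swap_apply_left] at h2
  rw [← h1, ← h2]

/-- **`⟨S⟩ = #plaquettes · ⟨φ_{x,ij}⟩`** for every site `x` and all `i ≠ j`. [folklore] -/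
theorem wilsonExpectation_wilsonAction_eq_card_mul [NeZero L] (hρ : Continuous ρ) (β : ℝ)
    (x : Site d L) {i j : Fin d} (hij : i ≠ j) :
    wilsonExpectation ρ β (wilsonAction (d := d) (L := L) (G := G) ρ) =
      (Fintype.card (Plaquette d L) : ℝ) * wilsonExpectation ρ β (plaquetteCost ρ x i j) := by
  have h : wilsonExpectation ρ β (wilsonAction (d := d) (L := L) (G := G) ρ) =
      ∑ p : Plaquette d L, wilsonExpectation ρ β (plaquetteCost (G := G) ρ p.1 p.2.1.1 p.2.1.2) := by
    simp only [wilsonExpectation, wilsonAction_eq_sum_plaquetteCost]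
    rw [← integral_finsetSum _ fun p _ => integrable_plaquetteCost ρ hρ β p]
  rw [h, Finset.sum_congr rfl fun (p : Plaquette d L) _ =>
    (wilsonExpectation_plaquetteCost_eq ρ hρ β p.1 (ne_of_lt p.2.2) hij).trans
      (wilsonExpectation_plaquetteCost_eq ρ hρ β x hij hij).symm,
    Finset.sum_const, Finset.card_univ, nsmul_eq_mul]

end Plaquette

/-! ### The single plaquette at weak coupling -/

variable {d N : ℕ} {G : Type} [Group G] [TopologicalSpace G] [IsTopologicalGroup G]
  [CompactSpace G] [MeasurableSpace G] [BorelSpace G]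

/-- **The single-plaquette expectation at weak coupling.** For `d ≥ 2`, `N ≥ 1` and every unitary
model (`G ≅ U(N)` through `ρ`): for every `ε > 0`, for all large `β` and then all large tori, for
EVERY plaquette (any base point, any ordered pair of distinct directions),
`|β ⟨N - Re tr ρ(U_{x,ij})⟩_{Λ_{L+1},β} - N²/d| ≤ ε`. [cite: arXiv160201222, Thm. 2.1] -/
theorem weakCoupling_singlePlaquette (ρ : G →* Matrix (Fin N) (Fin N) ℂ) (hd : 2 ≤ d) (hN : 1 ≤ N)
    (hρ : IsUnitaryModel ρ) :
    ∀ ε > 0, ∀ᶠ β : ℝ in atTop, ∀ᶠ L : ℕ in atTop, ∀ (x : Site d (L + 1)) (i j : Fin d), i ≠ j →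
      |β * wilsonExpectation ρ β (plaquetteCost ρ x i j) - (N : ℝ) ^ 2 / d| ≤ ε := by
  intro ε hε
  have hρc : Continuous ρ := hρ.1
  filter_upwards [weakCoupling_meanPlaquette ρ hd hN hρ ε hε] with β hβ
  filter_upwards [hβ] with L hL x i j hij
  have hcard : (Fintype.card (Plaquette d (L + 1)) : ℝ) ≠ 0 := by
    rw [card_plaquette_eq]
    have hd' : (2 : ℝ) ≤ d := by exact_mod_cast hd
    have h1 : (0 : ℝ) < (d : ℝ) * ((d : ℝ) - 1) / 2 := by nlinarith
    positivity
  rw [wilsonExpectation_wilsonAction_eq_card_mul ρ hρc β x hij, mul_comm (Fintype.card _ : ℝ),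
    ← mul_assoc, mul_div_assoc, div_self hcard, mul_one] at hL
  exact hL

end Summit.QuantumFields.YangMills.Theorems.SoloBlind
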